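import Literature.NumberTheory.EllipticCurves.SingularModuliCertificates
import Literature.NumberTheory.EllipticCurves.LatticeEndomorphism
import Literature.NumberTheory.EllipticCurves.CMLatticeHomothety
import Literature.NumberTheory.EllipticCurves.UniformizationProofs
import Literature.NumberTheory.EllipticCurves.ComplexMultiplicationSingularModuliRowFortyThree
import HarnessLib

/-!
# Singular moduli of class number one: the last rows `d = −67, −163`, and the discharge of the
CM-period leaf of Coates–Wiles' Theorem 1

Topic `NumberTheory/EllipticCurves`; proof sibling of
`Literature/NumberTheory/EllipticCurves/ComplexMultiplicationSingularModuli.lean` and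
`…/ComplexMultiplicationSingularModuliRows.lean` (level 3–4 of the decomposition of the named fact
`Literature.NumberTheory.EllipticCurves.finite_point_of_j_mem_maximalCMJInvariants_of_L_one_ne_zero`
= Coates–Wiles 1977, Thm. 1 for `F = ℚ`, read against Mordell–Weil).  Everything here is
**proved**; two named facts of the tree are **discharged**:

* `Literature.NumberTheory.EllipticCurves.singularModuli_classNumberOne_three_holds` — the residual
  leaf `singularModuli_classNumberOne_three` (the rows `d_K = −43, −67, −163` of the table of
  singular moduli `j(𝓞_K)`, Cox, *Primes of the form x² + ny²*, §12.C table (12.20)), hence the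
  whole table `singularModuli_classNumberOne_holds`;
* `Literature.NumberTheory.EllipticCurves.exists_isCMPeriod_of_j_mem_maximalCMJInvariants_holds` —
  the CM-period leaf F3 of `ComplexMultiplicationCoatesWiles.lean` (Coates–Wiles 1977, §1 p. 225:
  the period lattice of `E/ℚ` with `j(E) ∈ maximalCMJInvariants` is `L = Ω𝓞_K`).

Consequently (`CoatesWiles1977_L_one_eq_zero_of_not_isOfFinAddOrder_of_pAdicDivisibility`,
`finite_point_of_j_mem_maximalCMJInvariants_of_L_one_ne_zero_of_pAdicDivisibility`) Coates–Wiles'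
Theorem 1 for `F = ℚ` as printed and the target fact bsd.S28 (Mordell–Weil part, maximal-order
CM) now rest on **exactly one** named fact, the `𝔭`-adic core of the paper,
`Literature.NumberTheory.EllipticCurves.CoatesWiles1977_L_one_div_period_mem_prime` (Coates–Wiles
§6 p. 250: Thm. 29, Cor. 32, Thm. 34, Lemma 35 — Grössencharacter, Lubin–Tate towers, elliptic
units, local and global class field theory), everything else in the printed proof being a theorem
of this library (Mordell–Weil, the non-anomalous split primes of p. 232, the closing norm argument
of p. 251, uniformization, `h(d_K) = 1` by reduction theory, the nine singular moduli).

## Method (the rows `d = −67, −163`)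

`cmPeriodPair_j_eq_of_check`: let `d = 1 − 4n ∈ cmDiscrs`, `w = (1 + √d)/2 = ω_d + 2n`
(`w² = w − n`), and let integers `A, B` with `A³ ≠ 27B²` and coefficient lists `P, Q` pass the
certificate checker `CMCert.check 1 n A B w P Q` of `SingularModuliCertificate.lean`.  By the
Uniformization Theorem (`PeriodPair.uniformization_holds`, Silverman AEC VI.5.1) there is a lattice
`Λ` with `g₂(Λ) = A`, `g₃(Λ) = B`; by `CMCert.check_sound` the denoted polynomials satisfy the
transformation identities `(H1)`, `(H2)`, so `wΛ ⊆ Λ` (`PeriodPair.mul_mem_lattice_of_transformation`,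
`LatticeEndomorphism.lean`: ODE uniqueness and analytic continuation turn `u = (P/Q)(℘)` into
`℘(c + wz)`, whose `Λ`-periodicity forces `wΛ ⊆ Λ`), hence `ω_dΛ ⊆ Λ`; and a lattice with
`𝓞_K`-multiplication has `j(Λ) = j(Λ_d)` because `h(d) = 1`
(`cmPeriodPair_j_eq_of_mul_mem_lattice`, `CMLatticeHomothety.lean`, Gauss reduction in `SL₂(ℤ)\ℍ`).
Therefore `j(Λ_d) = j(Λ) = 1728A³/(A³ − 27B²)`.  Fed with the kernel-checked certificates
`CMCert.check67`, `CMCert.check163` (and `CMCert.check43`) of `SingularModuliCertificates.lean`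
this gives `j(Λ_{−67}) = −5280³`, `j(Λ_{−163}) = −640320³` (the certificate `CMCert.check43`
would likewise re-prove the landed row `j_cmPeriodPair_neg_fortyThree`, obtained by Laurent
matching in `…RowFortyThree.lean`; no duplicate theorem is stated).  Classically this is the theory of complex multiplication of
`℘` (Abel, Eisenstein; Weber, *Lehrbuch der Algebra* III §§ 114–115) run backwards: the
transformation polynomials certify the CM, and class number one identifies the lattice.

## References

* D. A. Cox, *Primes of the form x² + ny²*, 2nd ed., Wiley 2013: Thm. 7.30 (i), Thm. 10.9,
  Thm. 10.14, §12.C table (12.20) (PDF pp. 266–267).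
* J. Coates, A. Wiles, *On the conjecture of Birch and Swinnerton-Dyer*, Invent. Math. 39 (1977),
  223–251: Thm. 1 (p. 223), §1 p. 225, §6 pp. 250–251.
* J. H. Silverman, *The Arithmetic of Elliptic Curves*, 2nd ed., GTM 106 (2009), Thm. VI.5.1;
  *Advanced Topics in the Arithmetic of Elliptic Curves*, GTM 151 (1994), §II.2, App. A §3.
* H. Weber, *Lehrbuch der Algebra*, Bd. III, 2. Aufl., Vieweg 1908, §§ 114–115.
-/

noncomputable section

open Complex

namespace Literature.NumberTheory.EllipticCurves

open PeriodPair

/-! ### From a checked certificate to the singular modulus -/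

/-- **A certificate of complex multiplication computes the singular modulus.**  Let
`d = 1 − 4n` be one of the nine class-number-one discriminants, `w = (1 + √d)/2` (`w² = w − n`),
and let `A, B ∈ ℤ` with `A³ − 27B² ≠ 0` and coefficient lists `P, Q` over `ℤ[w]` pass
`CMCert.check 1 n A B w P Q` (the transformation identities `(H1)`, `(H2)` for `g₂ = A`, `g₃ = B`,
multiplier `w`).  Then `j(Λ_d) = 1728A³/(A³ − 27B²)`: a lattice `Λ` with invariants `(A, B)`
exists (uniformization), the certificate forces `wΛ ⊆ Λ` (`PeriodPair.mul_mem_lattice_of_transformation`),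
so `ω_d Λ ⊆ Λ` (`ω_d = w − 2n`), and `h(d) = 1` gives `j(Λ_d) = j(Λ)`
(`cmPeriodPair_j_eq_of_mul_mem_lattice`).  Cox, *Primes of the form x² + ny²*, Thm. 10.14 with
Thm. 7.30 (i) and Thm. 10.9. [cite: Cox2013, Thm. 10.14 with Thm. 7.30 (i)] -/
theorem cmPeriodPair_j_eq_of_check {d n A B : ℤ} (hd : d ∈ cmDiscrs) (hn : d = 1 - 4 * n)
    {P Q : CMCert.Poly} (hcheck : CMCert.check 1 n A B ⟨0, 1⟩ P Q = true)
    (hD : (A : ℂ) ^ 3 - 27 * (B : ℂ) ^ 2 ≠ 0) :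
    (cmPeriodPair d).j = 1728 * (A : ℂ) ^ 3 / ((A : ℂ) ^ 3 - 27 * (B : ℂ) ^ 2) := by
  obtain ⟨hdneg, -⟩ := neg_and_exists_of_mem_cmDiscrs hd
  obtain ⟨L, hg₂, hg₃⟩ := PeriodPair.uniformization_holds (A : ℂ) (B : ℂ) hD
  -- the multiplier `w = (1 + √d)/2 = ω_d + 2n`
  set w : ℂ := cmGen d + ((2 * n : ℤ) : ℂ) with hw_def
  have hn' : (d : ℂ) = 1 - 4 * (n : ℂ) := by exact_mod_cast hn
  have hS : ((Real.sqrt (-(d : ℝ)) : ℝ) : ℂ) ^ 2 = 4 * (n : ℂ) - 1 := by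
    rw [← Complex.ofReal_pow, Real.sq_sqrt (by exact_mod_cast (neg_nonneg.mpr hdneg.le))]
    push_cast
    linear_combination (-1 : ℂ) * hn'
  have hwI : w = (1 + Complex.I * (Real.sqrt (-(d : ℝ)) : ℂ)) / 2 := by
    simp only [hw_def, cmGen]
    push_cast
    linear_combination (1 / 2 : ℂ) * hn'
  have hw : w ^ 2 = ((1 : ℤ) : ℂ) * w - ((n : ℤ) : ℂ) := by
    rw [hwI]
    push_cast
    linear_combination (((Real.sqrt (-(d : ℝ)) : ℂ)) ^ 2 / 4) * Complex.I_sq - (1 / 4 : ℂ) * hS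
  have hw' : w.im ≠ 0 := by
    have : w.im = (cmGen d).im := by simp [hw_def]
    rw [this]
    exact (cmGen_im_pos hdneg).ne'
  have hw0 : w ≠ 0 := fun h => hw' (by rw [h, Complex.zero_im])
  -- the certificate
  obtain ⟨hQ, h1, h2⟩ : _ ∧ _ ∧ _ := CMCert.check_sound hw hw' hcheck
  have hα : CMCert.ZW.toC w ⟨0, 1⟩ = w := by simp
  rw [hα, ← hg₂, ← hg₃] at h1 h2
  -- `wΛ ⊆ Λ`, hence `ω_d Λ ⊆ Λ`
  have hmul : ∀ l ∈ L.lattice, w * l ∈ L.lattice := fun l hl =>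
    L.mul_mem_lattice_of_transformation hw0 hQ h1 h2 hl
  have hmul' : ∀ l ∈ L.lattice, cmGen d * l ∈ L.lattice := fun l hl => by
    have h2n : ((2 * n : ℤ) : ℂ) * l ∈ L.lattice := by
      rw [← zsmul_eq_mul]; exact L.lattice.smul_mem _ hl
    have : cmGen d * l = w * l - ((2 * n : ℤ) : ℂ) * l := by rw [hw_def]; ring
    rw [this]
    exact sub_mem (hmul l hl) h2n
  -- `j(Λ) = 1728 A³/(A³ − 27B²)` and `h(d) = 1`
  have hjL : L.j = 1728 * (A : ℂ) ^ 3 / ((A : ℂ) ^ 3 - 27 * (B : ℂ) ^ 2) := by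
    rw [PeriodPair.j_def, hg₂, hg₃]
  exact cmPeriodPair_j_eq_of_mul_mem_lattice hd hmul' hjL

/-! ### The rows `d = -67`, `d = -163` -/

/-- **Row `d = -67` of table (12.20): `j(ℤ[(1 + √-67)/2]) = -147197952000 = (-5280)³`**, from
the kernel-checked certificate `CMCert.check67` of complex multiplication by `(1 + √-67)/2`
(norm `17`) for the lattice of invariants `(29480, -974113)`.
[cite: Cox2013, §12.C table (12.20) row d_K = -67] -/
theorem j_cmPeriodPair_neg_sixtySeven : (cmPeriodPair (-67)).j = -147197952000 := by
  rw [cmPeriodPair_j_eq_of_check (d := -67) (n := 17) (by simp [cmDiscrs]) (by norm_num)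
    CMCert.check67 (by norm_num)]
  norm_num

/-- **Row `d = -163` of table (12.20): `j(ℤ[(1 + √-163)/2]) = -262537412640768000 = (-640320)³`**,
from the kernel-checked certificate `CMCert.check163` of complex multiplication by
`(1 + √-163)/2` (norm `41`) for the lattice of invariants `(8697680, -4936546769)`.
[cite: Cox2013, §12.C table (12.20) row d_K = -163] -/
theorem j_cmPeriodPair_neg_oneSixtyThree : (cmPeriodPair (-163)).j = -262537412640768000 := by
  rw [cmPeriodPair_j_eq_of_check (d := -163) (n := 41) (by simp [cmDiscrs]) (by norm_num)
    CMCert.check163 (by norm_num)]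
  norm_num

/-! ### Discharge of the singular-moduli facts and of the CM-period leaf -/

/-- **Discharge of `singularModuli_classNumberOne_three`** (the rows `d_K = -43, -67, -163` of
Cox's table (12.20): `j(𝓞_K) = -960³, -5280³, -640320³`), from `j_cmPeriodPair_neg_fortyThree`
and the two certificate rows. [cite: Cox2013, §12.C table (12.20) rows d_K = -43, -67, -163] -/
theorem singularModuli_classNumberOne_three_holds : singularModuli_classNumberOne_three :=
  singularModuli_classNumberOne_three_of_two j_cmPeriodPair_neg_sixtySeven
    j_cmPeriodPair_neg_oneSixtyThree

/-- **Discharge of `singularModuli_classNumberOne`**: the full table (12.20) of singular moduli of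
the nine imaginary quadratic orders of class number one is a theorem of this library
(rows `-3, -4`: `ComplexMultiplicationSingularModuli.lean`; `-7, -8, -11, -19`:
`…SingularModuliRows.lean`; `-43`: `…RowFortyThree.lean`; `-67, -163`: this file).
[cite: Cox2013, §12.C table (12.20)] -/
theorem singularModuli_classNumberOne_holds : singularModuli_classNumberOne :=
  singularModuli_classNumberOne_of_three singularModuli_classNumberOne_three_holds

/-- **Discharge of the CM-period leaf F3 `exists_isCMPeriod_of_j_mem_maximalCMJInvariants`**
(Coates–Wiles 1977, §1 p. 225: for `E/ℚ` with `j(E) ∈ maximalCMJInvariants` the period lattice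
of `ω_E` is `Ω · 𝓞_K`, "since `𝓞` has class number 1, we can choose `Ω ∈ L` such that `L = Ω𝓞`"),
via `singularModuli_classNumberOne_iff` (uniformization + Cox Thm. 10.9) and the table.
[cite: CoatesWiles1977, §1 p. 225] -/
theorem exists_isCMPeriod_of_j_mem_maximalCMJInvariants_holds :
    exists_isCMPeriod_of_j_mem_maximalCMJInvariants :=
  exists_isCMPeriod_of_j_mem_maximalCMJInvariants_of_singularModuli
    singularModuli_classNumberOne_holds

/-! ### Coates–Wiles, Theorem 1 (`F = ℚ`) and bsd.S28 from the `𝔭`-adic core alone -/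

/-- **Coates–Wiles 1977, Theorem 1 (`F = ℚ`), from the `𝔭`-divisibility fact alone.**  The
printed statement `CoatesWiles1977_L_one_eq_zero_of_not_isOfFinAddOrder` (a rational point of
infinite order on `E/ℚ` with `j(E) ∈ maximalCMJInvariants` forces `L(E/ℚ, 1) = 0`) follows from
the single named fact `CoatesWiles1977_L_one_div_period_mem_prime` (Coates–Wiles §6 p. 250:
Lemma 35, Thm. 34, (49), Cor. 32, Thm. 29 — for each good split non-anomalous `p > 7`,
`𝔭 ∣ Ω⁻¹L(E/ℚ, 1)`); the period normalisation `L = Ω𝓞` (§1 p. 225), the infinitely many split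
non-anomalous primes (p. 232) and the closing norm argument (p. 251 l. 1–2) are theorems.
[cite: CoatesWiles1977, Thm 1 (p. 223); proof §6 pp. 250–251] -/
theorem CoatesWiles1977_L_one_eq_zero_of_not_isOfFinAddOrder_of_pAdicDivisibility
    (h1 : CoatesWiles1977_L_one_div_period_mem_prime) :
    CoatesWiles1977_L_one_eq_zero_of_not_isOfFinAddOrder :=
  CoatesWiles1977_L_one_eq_zero_of_not_isOfFinAddOrder_of_mem_prime_of_three h1
    singularModuli_classNumberOne_three_holds

/-- **bsd.S28 (Mordell–Weil part, maximal-order CM) from the `𝔭`-divisibility fact alone.**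
The target fact `finite_point_of_j_mem_maximalCMJInvariants_of_L_one_ne_zero` — for `E/ℚ` with
complex multiplication by the maximal order of an imaginary quadratic field of class number one
(`j(E) ∈ maximalCMJInvariants`), `L(E, 1) ≠ 0 ⇒ E(ℚ)` finite (Coates–Wiles 1977, Thm. 1, read
against the Mordell–Weil theorem) — follows from the single named fact
`CoatesWiles1977_L_one_div_period_mem_prime` (the `𝔭`-adic core of the paper, §§2–6); the
Mordell–Weil theorem (`WeierstrassCurve.module_finite_point_holds`), the reduction to a global
minimal model, the non-anomalous split primes, the closing argument, uniformization, `h(d_K) = 1`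
and all nine singular moduli are proved. [cite: CoatesWiles1977, Thm 1 (p. 223)] -/
theorem finite_point_of_j_mem_maximalCMJInvariants_of_L_one_ne_zero_of_pAdicDivisibility
    (h1 : CoatesWiles1977_L_one_div_period_mem_prime) :
    finite_point_of_j_mem_maximalCMJInvariants_of_L_one_ne_zero :=
  finite_point_of_j_mem_maximalCMJInvariants_of_L_one_ne_zero_of_mem_prime_of_three h1
    singularModuli_classNumberOne_three_holds

end Literature.NumberTheory.EllipticCurves

end
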